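import Literature.MathematicalPhysics.QuantumFieldTheory.Balaban1983to89.B7
import Literature.MathematicalPhysics.QuantumFieldTheory.Balaban1983to89.B7Prop8PrintedConstants
import Literature.MathematicalPhysics.QuantumFieldTheory.Balaban1983to89.B7Prop10AsPrinted

/-!
# `Balaban1983to89.B7ConclGauge` — T. Bałaban, *Averaging operations for lattice gauge theories*, Commun. Math. Phys. **98** (1985) 17–51
[Balaban1985Averaging]: **the abstract gauge-transformation carriers `B7.GaugeOneStep` (Sect. F one step, Prop. 9) and `B7.GaugeData`
(Sect. E–F, Props. 8 and 10) of `B7.lean` INSTANTIATED on the concrete `ℤᵈ` objects of the lineage, and the decls of record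
`B7.Prop8Printed` (Prop. 8 p. 45), `B7.Prop9Printed` (Prop. 9 (199)–(200) p. 49) and `B7.Prop10Printed` (Prop. 10 (203)–(204) p. 50) PROVED
for these families** (model instances; `p8` and `p10` share ONE `gd : I₄ → GaugeData`, as `B7.Concl` requires).

statement-level skeleton of published theorems with citation tags; proofs where landed; nothing here is a claim about the Yang–Mills mass gap

CITATION HEADER (lean-in-tree rule).  Cell `lit-balaban`, unit `lit-balaban-r04` (owner of block B7, gen 6).  MODEL-INSTANCE file for SKELETON rows
`B7.Prop8`, `B7.Prop9`, `B7.Prop10` (decls of record `B7.Prop8Printed`, `B7.Prop9Printed`, `B7.Prop10Printed`, abstract; no `GaugeData` /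
`GaugeOneStep` family existed in the tree).  Kernels BY NAME: Prop. 8 WITH THE PRINTED CONSTANTS — `B7Prop8PrintedConstants.prop8_printed_of52`
[p05] (`C₃ = 1116`, `c₆ = 1/3000`); Prop. 9 IN PRINT'S SHAPE — `B7Ineq199General.eq199_printed` (`C′₄ = 2400(d+1)(d+4)`, no `α₀α′₄`-term) and
`B7Ineq200General.eq200_printed` (`C′₅ = 6d`, no `α₀`-term); Prop. 10 AS PRINTED — `B7Prop10AsPrinted.prop10_as_printed_of52` (`C₄ = 8C′₄C₅`,
(204) `rhs204`).

PRINT (verbatim).  Prop. 8 p. 45: "If `u₁, u₂ ∈ Λ_k(U₀, α₃)` and `α₃` is sufficiently small, i.e., `α₃ ≦ c₆` for some `c₆`, then `u = u₁u₂ ∈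
Λ_k(U₀, 2α₃ + 2C₃α₃²)` and we have (173)."  Prop. 9 p. 49: "There exist positive constants `C′₄, C′₅, c′₆` such that for arbitrary functions
`V₀, v′, v₁` satisfying (180) with `α₀, α₃, α′₃, α₄, α′₄ ≦ c′₆`, the following bounds hold: `|ṽ′⁻¹(c₋)R̄_{0,c}ṽ′(c₊) − 1| < Lα′₄ + C′₄L²(α₀α₄ + α′₃α′₄
+ α′₄²)`, (199) `|ṽ′(y) − 1| < α₄ + C′₅Lα′₄`. (200)"  Prop. 10 p. 50: "There exist positive constants `C₄, C₅, c₆` such that for arbitrary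
configurations `U₀, u′, u₁` satisfying (52), (176), (177), (166), (167) with `α₀, α₃, α₄ ≦ c₆` the bounds (203), (204) hold for `j ≦ k`."

THE FAMILIES.
* `concreteGaugeOneStep 𝔸 L` (index `PUnit`: the constants are plain numbers): `Cfg` = `U1`-valued configurations on `ℤᵈ` («`V₀`», (180a) via
  `plaqDev = pdev`); `GT` = BOUNDED unit-valued site functions (`∃ M, ‖v(y)‖, ‖v(y)⁻¹‖ ≤ M` — print's `v′ = e^{iλ}`, `λ ∈ 𝔤ᶜ` bounded, and the
  `G`-valued `v₁`; the bound makes the suprema below genuine); `dev v = sup_y‖v(y) − 1‖` ((180a)/(176)); `covDev V₀ v = sup_b‖v(b₋)⁻¹R(V₀(b))v(b₊) − 1‖`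
  ((180b), `B7Prop9General.CovBondBd`'s expression); `blockCovDev V₀ v = sup_{y,x∈B(y)}‖v(y)⁻¹(R_{0,y}v)(x) − 1‖` ((180d), `CovBlockBd`'s);
  `avgCovDev V₀ v₁ v′ = sup_c‖ṽ′(c₋)⁻¹R(V̄₀(c))ṽ′(c₊) − 1‖` (left side of (199), `ṽ′ = B7Prop9General.vtilG L V₀ v′ v₁`, `V̄₀ = bavg L V₀`);
  `avgDev V₀ v₁ v′ = sup_y‖ṽ′(Ly) − 1‖` (left side of (200)).
* `concreteGaugeData 𝔸 L` (𝔸 a C⋆-algebra — print's `M_N(ℂ)` —, `G = U(𝔸) = B7Prop2Explicit.unitaryUnits 𝔸`).  INDEX `i = (k, U₀)`: the order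
  `k` AND THE BACKGROUND `U₀` — a `U(𝔸)`-valued configuration with (52) at Prop. 2's `c₂ = min{1/(3C₀), ½c₂′}` (`pdev U₀·L^{2k} < c₂`) —; `Cfg i`
  = the singleton `{V // V = U₀}`.  The background sits in the index because the abstract field `Reg176 : ℝ → GT → Prop` of `B7.GaugeData` receives
  no configuration although (177) «`|u′⁻¹(b₋)R_{0,b}u′(b₊) − 1| < α₄η`» depends on `U₀` (finding F6 of `lit-balaban-r04/ROWS-B7.md`); the constants
  are chosen before `i`, i.e. uniformly in `U₀`, exactly as printed.  `GT` = all unit-valued site functions; `eta = L^{−k}`, `L = L`;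
  `plaqDevEta V = η⁻²·pdev V`; `InLambda V α₃ u` = «`u` is a gauge transformation (`U(𝔸)`-valued, p. 18) in `Λ_k(V, α₃)`» =
  `(∀ x, u x ∈ U(𝔸)) ∧ B7Eq167Flat.InLambda L V u k α₃ η` ((166)–(167)); `mul` = pointwise product; `Reg176 α₄ u′ = SiteBd u′ α₄ ∧ CovBondBd U₀ u′ (α₄η)`
  ((176)–(177), `u′` possibly non-unitary); `avgDev203 V u₁ u′ j = sup_c‖ũ′ʲ(c₋)⁻¹R(Ū₀ʲ(c))ũ′ʲ(c₊) − 1‖` (left side of (203), `ũ′ʲ = B7Prop10General.utilG`,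
  `Ū₀ʲ = avgIter`); `avgDev204 V u₁ u′ j = sup_y‖ũ′ʲ(y) − 1‖` (left side of (204)).

WHAT THIS FILE PROVES (kernel, no `sorry`, standard axioms).
* `prop9Printed_G (hL : 1 ≤ L) : B7.Prop9Printed L (concreteGaugeOneStep 𝔸 L)` — for EVERY `M > 0` (the typed proviso `α′₄ ≤ Mα₄` is not needed):
  `C′₄ = 2400(d+1)(d+4) + 1`, `C′₅ = 6d + 1`, `c′₆ = c9 d L = min{1/20, 1/50, 1/(50L), 1/(100(d+1)L), 1/(512(d+1)(d+4)L²)}` (the `+1`'s turn the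
  kernels' `≤` into the typed strict `<`, all `α`'s being positive).
* `prop8Printed_G (hL : 2 ≤ L) : B7.Prop8Printed (concreteGaugeData 𝔸 L)` — `C₃ = 1116`, `c₆ = 1/3000` (p05's printed constants; the unitarity of
  the level backgrounds from (52) at `c₂`, Prop. 2).
* `prop10Printed_G (hL : 2 ≤ L) : B7.Prop10Printed (concreteGaugeData 𝔸 L)` — `C₄ = B7Prop10Flat.C4 d + 1`, `C′₅ = B7Prop9Flat.C5' d + 1`, `c₆ = c10 d L`
  explicit (depends on `d`, `L`); (204)'s typed closed form `α₄(1 + 4C′₅Lʲη)` from `rhs204` by `Lη + … + Lʲη ≤ 2Lʲη` (`B7Eq167Flat.sum_pow_succ_le`).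
* `p8_and_p10_G` — the conjunction for the shared family.
READINGS (located, inherited): Banach/C⋆ carriers (`U1 ⊇ G`, `U(𝔸)` for `U(N)`); `≤` in the instance predicates `InLambda`/`Reg176` for print's
`<` (a weaker hypothesis, so the typed implications are stronger); the index convention for `GaugeData` above.  NOT CLAIMED: (173) is not a field
of the carrier (it is `B7Prop8General.eq173_general`); nothing beyond the three typed statements.
DECLARATIONS: `BddUnits`, `concreteGaugeOneStep`, `c9`, `GIdx`, `cB`, `concreteGaugeData`, `c10`, theorems.  Unit `lit-balaban-r04` (gen 6), 2026-08-21.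

v1.1 (unit `lit-balaban-r04` gen 22, DOCSTRING-ONLY; every declaration byte-identical with v1.0 p259182): the locator «Proposition 10
(203)–(204) p.50» split into «Proposition 10 p.50, (203)–(204) p.49» in the header tag and in one `[cite:]` tag (own-stem locator audit of
the `[cite: Balaban1985Averaging, …]` tags against a display→page map of CMP 98 built from the held text layer
`paper:balaban1985-cmp98-averaging` and verified on the ×2 renders `…/1985-cmp98-averaging-p0NN-x2.png`: (198)–(206) stand on p. 49
(render p033), Proposition 10 with (207) at the head of p. 50).

[cite: Balaban1985Averaging, Proposition 8 p.45, Proposition 9 (199)–(200) p.49, Proposition 10 p.50, (203)–(204) p.49, (166)–(167) p.44, (176)–(180) pp.45–46, (52) p.26]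
-/

noncomputable section

open scoped BigOperators
open NormedSpace Finset

namespace Literature.MathematicalPhysics.QuantumFieldTheory.Balaban1983to89.B7ConclGauge

open B7Prop1Explicit B7Prop2Explicit B7Eq92Concrete B7Eq99Concrete B7Eq84Concrete B7Eq167Flat B7Prop9Flat B7Prop9General
  B7Prop10General
open B7Prop10Flat (rhs204 C4 C5 C5'_nonneg C4'_nonneg one_le_C5)

-- `Site` alone would resolve to the torus sites of `Setup.lean`; re-export the `ℤ^d` sites of `B7Prop1Explicit`.
export B7Prop1Explicit (Site)

variable {d : ℕ}

/-! ## §1 Bounded unit-valued site functions and an elementary bound -/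

/-- BOUNDED `𝔸ˣ`-valued site functions (values and inverses bounded): print's `v′ = e^{iλ}`, `λ ∈ 𝔤ᶜ` with `|v′ − 1| < α₄` (p. 45), and the
`G`-valued gauge transformations `v₁`; the bound makes `sup_y|v(y) − 1|` and the covariant suprema of (180) genuine suprema.
[cite: Balaban1985Averaging, (176)–(177) p.45, (180) p.46] -/
def BddUnits (d : ℕ) (𝔸 : Type) [NormedRing 𝔸] : Type :=
  {v : Site d → 𝔸ˣ // ∃ M : ℝ, ∀ y : Site d, ‖((v y : 𝔸ˣ) : 𝔸)‖ ≤ M ∧ ‖(((v y)⁻¹ : 𝔸ˣ) : 𝔸)‖ ≤ M}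

section Elementary

variable {𝔸 : Type} [NormedRing 𝔸] [NormOneClass 𝔸]

/-- `‖a⁻¹·R(T)b − 1‖ ≤ M² + 1` for `‖a⁻¹‖, ‖b‖ ≤ M` and `T ∈ {|u| ≤ 1, |u⁻¹| ≤ 1}` ((56) `R(T)b = TbT⁻¹`) — boundedness of the covariant
deviations (180b), (180d). [cite: Balaban1985Averaging, (56) p.27, (180) p.46] -/
theorem norm_inv_mul_Rc_sub_one_le {a b T : 𝔸ˣ} (hT : T ∈ U1 𝔸) {M : ℝ} (hM : 0 ≤ M)
    (ha : ‖((a⁻¹ : 𝔸ˣ) : 𝔸)‖ ≤ M) (hb : ‖(b : 𝔸)‖ ≤ M) :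
    ‖((a⁻¹ * Rc T b : 𝔸ˣ) : 𝔸) - 1‖ ≤ M * M + 1 := by
  obtain ⟨hT1, hT2⟩ := mem_U1.1 hT
  refine (norm_sub_le _ _).trans ?_
  rw [norm_one, Rc_apply, Units.val_mul, Units.val_mul, Units.val_mul]
  have h1 : ‖((a⁻¹ : 𝔸ˣ) : 𝔸) * (((T : 𝔸) * (b : 𝔸)) * ((T⁻¹ : 𝔸ˣ) : 𝔸))‖ ≤ M * ((1 * M) * 1) := by
    refine (norm_mul_le _ _).trans (mul_le_mul ha ?_ (norm_nonneg _) hM)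
    refine (norm_mul_le _ _).trans (mul_le_mul ?_ hT2 (norm_nonneg _) (by positivity))
    exact (norm_mul_le _ _).trans (mul_le_mul hT1 hb (norm_nonneg _) zero_le_one)
  have h2 : ((a⁻¹ : 𝔸ˣ) : 𝔸) * ((T : 𝔸) * (b : 𝔸) * ((T⁻¹ : 𝔸ˣ) : 𝔸))
      = ((a⁻¹ : 𝔸ˣ) : 𝔸) * (((T : 𝔸) * (b : 𝔸)) * ((T⁻¹ : 𝔸ˣ) : 𝔸)) := by rw [mul_assoc]
  rw [h2]
  linarith

/-- the site deviations of a bounded unit function are bounded (`sup_y‖v(y) − 1‖` is a genuine supremum). [cite: Balaban1985Averaging, (176) p.45] -/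
theorem dev_bddAbove (v : BddUnits d 𝔸) : BddAbove (Set.range fun y : Site d => ‖((v.1 y : 𝔸ˣ) : 𝔸) - 1‖) := by
  obtain ⟨M, hM⟩ := v.2
  refine ⟨M + 1, ?_⟩
  rintro _ ⟨y, rfl⟩
  refine (norm_sub_le _ _).trans ?_
  rw [norm_one]
  linarith [(hM y).1]

/-- the covariant bond deviations (180b) of a bounded unit function at a `U1`-valued background are bounded. [cite: Balaban1985Averaging, (180) p.46] -/
theorem covDev_bddAbove {V₀ : Site d → Fin d → 𝔸ˣ} (hV : ∀ (x : Site d) (κ : Fin d), V₀ x κ ∈ U1 𝔸) (v : BddUnits d 𝔸) :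
    BddAbove (Set.range fun b : Site d × Fin d =>
      ‖((((v.1 b.1)⁻¹ * Rc (V₀ b.1 b.2) (v.1 (b.1 + e b.2)) : 𝔸ˣ)) : 𝔸) - 1‖) := by
  obtain ⟨M, hM⟩ := v.2
  have hM0 : 0 ≤ M := (norm_nonneg _).trans (hM 0).1
  refine ⟨M * M + 1, ?_⟩
  rintro _ ⟨b, rfl⟩
  exact norm_inv_mul_Rc_sub_one_le (hV b.1 b.2) hM0 (hM b.1).2 (hM _).1

/-- the covariant block deviations (180d) of a bounded unit function at a `U1`-valued background are bounded. [cite: Balaban1985Averaging, (180) p.46] -/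
theorem blockCovDev_bddAbove {L : ℕ} {V₀ : Site d → Fin d → 𝔸ˣ} (hV : ∀ (x : Site d) (κ : Fin d), V₀ x κ ∈ U1 𝔸) (v : BddUnits d 𝔸) :
    BddAbove (Set.range fun p : Site d × (Fin d → Fin L) =>
      ‖((((v.1 ((L : ℤ) • p.1))⁻¹ * R0fun V₀ ((L : ℤ) • p.1) v.1 ((L : ℤ) • p.1 + boxVec L p.2) : 𝔸ˣ)) : 𝔸) - 1‖) := by
  obtain ⟨M, hM⟩ := v.2
  have hM0 : 0 ≤ M := (norm_nonneg _).trans (hM 0).1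
  refine ⟨M * M + 1, ?_⟩
  rintro _ ⟨p, rfl⟩
  exact norm_inv_mul_Rc_sub_one_le (hol_mem hV _ _) hM0 (hM _).2 (hM _).1

end Elementary

/-! ## §2 The one-step family of Sect. F and Proposition 9 -/

section OneStep

variable (𝔸 : Type) [NormedRing 𝔸] [NormOneClass 𝔸] [NormedAlgebra ℂ 𝔸] [CompleteSpace 𝔸]

/-- **The concrete one-step family of Sect. F** (see the module docstring for every field): `Cfg` = `U1`-valued configurations, `GT` = bounded unit
site functions, and the six deviation functionals of (180)/(199)/(200) as suprema of the lineage's pointwise expressions (`CovBondBd`, `CovBlockBd`,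
`vtilG`). [cite: Balaban1985Averaging, (178)–(180) pp.45–46, (199)–(200) p.49] -/
def concreteGaugeOneStep (L : ℕ) (_i : PUnit) : B7.GaugeOneStep where
  Cfg := {V : Site d → Fin d → 𝔸ˣ // ∀ (x : Site d) (κ : Fin d), V x κ ∈ U1 𝔸}
  GT := BddUnits d 𝔸
  plaqDev V := pdev V.1
  dev v := ⨆ y : Site d, ‖((v.1 y : 𝔸ˣ) : 𝔸) - 1‖
  covDev V v := ⨆ b : Site d × Fin d, ‖((((v.1 b.1)⁻¹ * Rc (V.1 b.1 b.2) (v.1 (b.1 + e b.2)) : 𝔸ˣ)) : 𝔸) - 1‖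
  blockCovDev V v := ⨆ p : Site d × (Fin d → Fin L),
    ‖((((v.1 ((L : ℤ) • p.1))⁻¹ * R0fun V.1 ((L : ℤ) • p.1) v.1 ((L : ℤ) • p.1 + boxVec L p.2) : 𝔸ˣ)) : 𝔸) - 1‖
  avgCovDev V v₁ v' := ⨆ c : Site d × Fin d,
    ‖((((vtilG L V.1 v'.1 v₁.1 ((L : ℤ) • c.1))⁻¹ *
        Rc (bavg L V.1 ((L : ℤ) • c.1) c.2) (vtilG L V.1 v'.1 v₁.1 ((L : ℤ) • (c.1 + e c.2))) : 𝔸ˣ)) : 𝔸) - 1‖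
  avgDev V v₁ v' := ⨆ z : Site d, ‖((vtilG L V.1 v'.1 v₁.1 ((L : ℤ) • z) : 𝔸ˣ) : 𝔸) - 1‖

end OneStep

/-- the threshold `c′₆ = c′₆(d, L)` of Prop. 9 (print: «positive constants C′₄, C′₅, c′₆»; their dependence is not stated, note N-B7-F2): the
minimum of the explicit smallness conditions of `B7Ineq199General.eq199_printed`. [cite: Balaban1985Averaging, Proposition 9 p.49] -/
def c9 (d L : ℕ) : ℝ :=
  min (1 / 20) <| min (1 / 50) <| min (1 / (50 * (L : ℝ))) <| min (1 / (100 * ((d : ℝ) + 1) * (L : ℝ)))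
    (1 / (512 * ((d : ℝ) + 1) * ((d : ℝ) + 4) * (L : ℝ) ^ 2))

/-- `c9 d L > 0` (`L ≥ 1`). [cite: Balaban1985Averaging, Proposition 9 p.49] -/
theorem c9_pos (d : ℕ) {L : ℕ} (hL : 1 ≤ L) : 0 < c9 d L := by
  have hL0 : (0 : ℝ) < L := by exact_mod_cast hL
  unfold c9
  exact lt_min (by norm_num) (lt_min (by norm_num) (lt_min (by positivity) (lt_min (by positivity) (by positivity))))

/-- unpacking `c9`. [cite: Balaban1985Averaging, Proposition 9 p.49] -/
theorem c9_le (d L : ℕ) :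
    c9 d L ≤ 1 / 20 ∧ c9 d L ≤ 1 / 50 ∧ c9 d L ≤ 1 / (50 * (L : ℝ)) ∧ c9 d L ≤ 1 / (100 * ((d : ℝ) + 1) * (L : ℝ)) ∧
      c9 d L ≤ 1 / (512 * ((d : ℝ) + 1) * ((d : ℝ) + 4) * (L : ℝ) ^ 2) := by
  unfold c9
  refine ⟨min_le_left _ _, ?_, ?_, ?_, ?_⟩ <;> simp only [min_le_iff, le_refl, true_or, or_true]

section Prop9

variable {𝔸 : Type} [NormedRing 𝔸] [NormOneClass 𝔸] [NormedAlgebra ℂ 𝔸] [CompleteSpace 𝔸]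

/-- **Proposition 9 (199)–(200) AS TYPED (`B7.Prop9Printed`) for `concreteGaugeOneStep 𝔸 L`**, every `d`, every `L ≥ 1`, `𝔸` any complete normed
`ℂ`-algebra with `‖1‖ = 1`, and EVERY ratio `M > 0` of the typed proviso (unused): `C′₄ = 2400(d+1)(d+4) + 1`, `C′₅ = 6d + 1`, `c′₆ = c9 d L`.  The
hypotheses of the typed statement (suprema `<` the `α`'s) give the pointwise (180a)–(180d) with `≤` (`le_ciSup`, the functions being bounded); then
`B7Ineq199General.eq199_printed` bounds every term of `avgCovDev` by `Lα′₄ + 2400(d+1)(d+4)L²(α₀α₄ + α′₃α′₄ + α′₄²)` and `B7Ineq200General.eq200_printed`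
every term of `avgDev` by `α₄ + 6dLα′₄`; the suprema follow (`Real.iSup_le`) and are STRICTLY below the bounds with the constants `+1` since all `α`'s
are positive. [cite: Balaban1985Averaging, Proposition 9 (199)–(200) p.49, (180) p.46] -/
theorem prop9Printed_G (L : ℕ) (hL : 1 ≤ L) :
    B7.Prop9Printed (L : ℝ) (concreteGaugeOneStep 𝔸 (d := d) L) := by
  intro M _hM
  have hL0 : (0 : ℝ) < L := by exact_mod_cast hL
  have hd : (0 : ℝ) ≤ d := Nat.cast_nonneg d
  refine ⟨2400 * ((d : ℝ) + 1) * ((d : ℝ) + 4) + 1, 6 * (d : ℝ) + 1, c9 d L, by positivity, by positivity, c9_pos d hL, ?_⟩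
  rintro ⟨⟩ α₀ α₃ α₃' α₄ α₄' hα₀ hα₀c hα₃ hα₃c hα₃' hα₃'c hα₄ hα₄c hα₄' hα₄'c _hratio ⟨V₀, hV₀⟩ v' v₁ hdev h4a h4b h3c h3d
  dsimp only [concreteGaugeOneStep] at hdev h4a h4b h3c h3d ⊢
  obtain ⟨c20, c50, c50L, c100, c512⟩ := c9_le d L
  -- the pointwise hypotheses (180a)–(180d), with `≤`
  have h44 : ∀ (x : Site d) (κ μ : Fin d), κ ≠ μ → ‖((hol V₀ x (plaqWord κ μ) : 𝔸ˣ) : 𝔸) - 1‖ ≤ α₀ :=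
    fun x κ μ _ => (le_pdev hV₀ x κ μ).trans hdev.le
  have hS' : SiteBd v'.1 α₄ := fun y => (le_ciSup (dev_bddAbove v') y).trans h4a.le
  have hC' : CovBondBd V₀ v'.1 α₄' := fun x κ => (le_ciSup (covDev_bddAbove hV₀ v') (x, κ)).trans h4b.le
  have hS₁ : SiteBd v₁.1 α₃ := fun y => (le_ciSup (dev_bddAbove v₁) y).trans h3c.le
  have hB₁ : CovBlockBd L V₀ v₁.1 ((L : ℝ) * α₃') := fun z r =>
    (le_ciSup (blockCovDev_bddAbove (L := L) hV₀ v₁) (z, r)).trans h3d.le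
  -- the thresholds
  have hα₄s : α₄ ≤ 1 / 20 := hα₄c.trans c20
  have hα₃s : α₃ ≤ 1 / 50 := hα₃c.trans c50
  have hα₃'s : 50 * ((L : ℝ) * α₃') ≤ 1 := by
    have h := hα₃'c.trans c50L
    rw [le_div_iff₀ (by positivity)] at h
    linarith
  have hs : 100 * ((d : ℝ) * L * α₄') ≤ 1 := by
    have h := hα₄'c.trans c100
    rw [le_div_iff₀ (by positivity)] at h
    nlinarith
  have hα₀s : 512 * ((d : ℝ) + 1) * ((d : ℝ) + 4) * (L : ℝ) ^ 2 * α₀ ≤ 1 := by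
    have h := hα₀c.trans c512
    rw [le_div_iff₀ (by positivity)] at h
    linarith
  refine ⟨?_, ?_⟩
  · -- (199)
    have hpt : ∀ c : Site d × Fin d,
        ‖((((vtilG L V₀ v'.1 v₁.1 ((L : ℤ) • c.1))⁻¹ *
            Rc (bavg L V₀ ((L : ℤ) • c.1) c.2) (vtilG L V₀ v'.1 v₁.1 ((L : ℤ) • (c.1 + e c.2))) : 𝔸ˣ)) : 𝔸) - 1‖
          ≤ L * α₄' + 2400 * ((d : ℝ) + 1) * ((d : ℝ) + 4) * L ^ 2 * (α₀ * α₄ + α₃' * α₄' + α₄' ^ 2) :=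
      fun c => B7Ineq199General.eq199_printed hL hV₀ hα₀.le h44 hS' hC' hS₁ hB₁ hα₄s hα₄'.le hα₃s hα₃'s hs hα₀s c.1 c.2
    have hβ : 0 < (L : ℝ) ^ 2 * (α₀ * α₄ + α₃' * α₄' + α₄' ^ 2) := by positivity
    refine lt_of_le_of_lt (Real.iSup_le hpt (by positivity)) ?_
    nlinarith
  · -- (200)
    have hpt : ∀ z : Site d, ‖((vtilG L V₀ v'.1 v₁.1 ((L : ℤ) • z) : 𝔸ˣ) : 𝔸) - 1‖ ≤ α₄ + 6 * d * L * α₄' :=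
      fun z => B7Ineq200General.eq200_printed hL hV₀ hS' hC' hS₁ hB₁ (hα₄s.trans (by norm_num)) hα₄'.le hα₃s (by linarith) hs z
    refine lt_of_le_of_lt (Real.iSup_le hpt (by positivity)) ?_
    have : 0 < (L : ℝ) * α₄' := by positivity
    nlinarith

end Prop9

/-! ## §3 The gauge-transformation family of Sects. E–F and Propositions 8, 10 -/

/-- Prop. 2's `c₂ = min{1/(3C₀), ½c₂′}` (p. 26) with the lineage's `C₀ = B7Prop2Explicit.C0 d`, `c₂′ = B7Prop2Explicit.c2' d L`: the (52)-level of the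
backgrounds in the index of `concreteGaugeData`. [cite: Balaban1985Averaging, Proposition 2 p.26] -/
def cB (d L : ℕ) : ℝ := min (1 / (3 * C0 d)) (c2' d L / 2)

/-- `cB > 0` (`L ≥ 1`). [cite: Balaban1985Averaging, Proposition 2 p.26] -/
theorem cB_pos (d : ℕ) {L : ℕ} (hL : 1 ≤ L) : 0 < cB d L := by
  have hL0 : (0 : ℝ) < L := by exact_mod_cast hL
  have h1 := C0_pos d
  have h2 : 0 < c2' d L := by unfold c2'; positivity
  unfold cB
  exact lt_min (by positivity) (by linarith)

/-- Prop. 2's hypotheses at `α₀ = cB`: `C₀·cB ≤ ⅓` and `2cB ≤ c₂′`. [cite: Balaban1985Averaging, Proposition 2 p.26] -/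
theorem cB_spec (d L : ℕ) : C0 d * cB d L ≤ 1 / 3 ∧ 2 * cB d L ≤ c2' d L := by
  have h1 := C0_pos d
  refine ⟨?_, by unfold cB; linarith [min_le_right (1 / (3 * C0 d)) (c2' d L / 2)]⟩
  have h := min_le_left (1 / (3 * C0 d)) (c2' d L / 2)
  unfold cB
  rw [le_div_iff₀ (by positivity)] at h
  linarith

section GaugeData

variable (𝔸 : Type) [CStarAlgebra 𝔸] [Nontrivial 𝔸]

/-- **The index of the gauge-transformation family**: the order `k` and the background `U₀` — a `U(𝔸)`-valued configuration on `ℤᵈ` satisfying (52)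
with `α₀ = c₂` (Prop. 2's constant, `cB d L`): `sup_p‖U₀(∂p) − 1‖·L^{2k} < c₂`.  (The background is index data because the abstract `Reg176` of
`B7.GaugeData` has no configuration argument while (177) depends on `U₀` — see the module docstring.) [cite: Balaban1985Averaging, (52) p.26, (177) p.45] -/
structure GIdx (d L : ℕ) where
  /-- the order `k` (`η = L^{−k}`) -/
  k : ℕ
  /-- the background `U₀` -/
  U₀ : Site d → Fin d → 𝔸ˣ
  /-- `U₀` is `U(𝔸)`-valued -/
  hU₀ : ∀ (x : Site d) (κ : Fin d), U₀ x κ ∈ unitaryUnits 𝔸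
  /-- (52) at `α₀ = c₂` -/
  h52 : pdev U₀ * ((L : ℝ) ^ k) ^ 2 < cB d L

/-- **The concrete gauge-transformation family of Sects. E–F** (see the module docstring for every field): `Cfg i = {V // V = U₀}`, `GT` = all unit site
functions, `plaqDevEta = η⁻²·pdev`, `InLambda V α₃ u = (u is U(𝔸)-valued) ∧ u ∈ Λ_k(V, α₃)` ((166)–(167), `B7Eq167Flat.InLambda`), `mul` pointwise,
`Reg176 α₄ u′ = (176) ∧ (177)` at `U₀`, `avgDev203`/`avgDev204` = the suprema of the left sides of (203)/(204) for `ũ′ʲ = utilG L V u′ u₁ j` at the level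
backgrounds `Ū₀ʲ = avgIter L V j`. [cite: Balaban1985Averaging, (166)–(167) p.44, (176)–(179) p.45, (203)–(204) p.49] -/
def concreteGaugeData (L : ℕ) (i : GIdx 𝔸 d L) : B7.GaugeData where
  Cfg := {V : Site d → Fin d → 𝔸ˣ // V = i.U₀}
  GT := Site d → 𝔸ˣ
  k := i.k
  eta := ((L : ℝ) ^ i.k)⁻¹
  L := L
  plaqDevEta V := pdev V.1 * ((L : ℝ) ^ i.k) ^ 2
  InLambda V α₃ u := (∀ x : Site d, u x ∈ unitaryUnits 𝔸) ∧ InLambda L V.1 u i.k α₃ (((L : ℝ) ^ i.k)⁻¹)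
  mul u₁ u₂ := u₁ * u₂
  Reg176 α₄ u' := SiteBd u' α₄ ∧ CovBondBd i.U₀ u' (α₄ * ((L : ℝ) ^ i.k)⁻¹)
  avgDev203 V u₁ u' j := ⨆ c : Site d × Fin d,
    ‖((((utilG L V.1 u' u₁ j c.1)⁻¹ * Rc (avgIter L V.1 j c.1 c.2) (utilG L V.1 u' u₁ j (c.1 + e c.2)) : 𝔸ˣ)) : 𝔸) - 1‖
  avgDev204 V u₁ u' j := ⨆ y : Site d, ‖((utilG L V.1 u' u₁ j y : 𝔸ˣ) : 𝔸) - 1‖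

end GaugeData

/-- the threshold `c₆ = c₆(d, L)` of Prop. 10: the minimum of the explicit smallness conditions of `B7Prop10AsPrinted.prop10_as_printed_of52` (and Prop. 2's
`c₂`). [cite: Balaban1985Averaging, Proposition 10 p.50] -/
def c10 (d L : ℕ) : ℝ :=
  min (cB d L) <| min (1 / 50) <| min (1 / (20 * C5 d)) <| min (1 / (200 * ((d : ℝ) + 1) * (L : ℝ))) <| min (1 / (3 * C4 d))
    (1 / (1024 * ((d : ℝ) + 1) * ((d : ℝ) + 4) * (L : ℝ) ^ 2))

/-- `c10 > 0` (`L ≥ 1`). [cite: Balaban1985Averaging, Proposition 10 p.50] -/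
theorem c10_pos (d : ℕ) {L : ℕ} (hL : 1 ≤ L) : 0 < c10 d L := by
  have hL0 : (0 : ℝ) < L := by exact_mod_cast hL
  have h5 : 0 < C5 d := by linarith [one_le_C5 (d := d)]
  have h4' : 0 < B7Prop9Flat.C4' d := by unfold B7Prop9Flat.C4'; positivity
  have h4 : 0 < C4 d := by unfold C4; positivity
  unfold c10
  exact lt_min (cB_pos d hL) (lt_min (by norm_num) (lt_min (by positivity) (lt_min (by positivity) (lt_min (by positivity)
    (by positivity)))))

/-- unpacking `c10`. [cite: Balaban1985Averaging, Proposition 10 p.50] -/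
theorem c10_le (d L : ℕ) :
    c10 d L ≤ cB d L ∧ c10 d L ≤ 1 / 50 ∧ c10 d L ≤ 1 / (20 * C5 d) ∧ c10 d L ≤ 1 / (200 * ((d : ℝ) + 1) * (L : ℝ)) ∧
      c10 d L ≤ 1 / (3 * C4 d) ∧ c10 d L ≤ 1 / (1024 * ((d : ℝ) + 1) * ((d : ℝ) + 4) * (L : ℝ) ^ 2) := by
  unfold c10
  refine ⟨min_le_left _ _, ?_, ?_, ?_, ?_, ?_⟩ <;> simp only [min_le_iff, le_refl, true_or, or_true]

/-- (204)'s typed closed form: `α₄ + 2C′₅α₄(Lη + … + Lʲη) ≤ α₄(1 + 4C′₅Lʲη)` for `L ≥ 2` (`Lη + … + Lʲη ≤ 2Lʲη`,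
`B7Eq167Flat.sum_pow_succ_le`). [cite: Balaban1985Averaging, (204) p.49, Proposition 10 p.50] -/
theorem rhs204_le_level {L : ℕ} (hL : 2 ≤ L) (j : ℕ) {α₄ η : ℝ} (hα₄ : 0 ≤ α₄) (hη : 0 ≤ η) :
    rhs204 d L j α₄ η ≤ α₄ * (1 + 4 * C5' d * ((L : ℝ) ^ j * η)) := by
  have hLr : (2 : ℝ) ≤ L := by exact_mod_cast hL
  have hs := sum_pow_succ_le hLr 0 j
  simp only [zero_add] at hs
  have hC := C5'_nonneg (d := d)
  unfold rhs204
  rw [← sum_mul]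
  have h1 : (∑ i ∈ range j, (L : ℝ) ^ (i + 1)) * η ≤ 2 * (L : ℝ) ^ j * η := mul_le_mul_of_nonneg_right hs hη
  have h0 : 0 ≤ 2 * C5' d * α₄ := by positivity
  nlinarith [mul_le_mul_of_nonneg_left h1 h0]

section Dev52

variable {𝔸 : Type} [NormedRing 𝔸]

/-- the level hypothesis (52) of an index: `pdev U₀ < c₂·η²`, and (52) at any finer `α₀` from the carrier's deviation functional.
[cite: Balaban1985Averaging, (52) p.26] -/
theorem h52_of_lt {L : ℕ} (hL : 1 ≤ L) {U₀ : Site d → Fin d → 𝔸ˣ} {k : ℕ} {α : ℝ}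
    (h : pdev U₀ * ((L : ℝ) ^ k) ^ 2 < α) : pdev U₀ < α * (((L : ℝ) ^ k)⁻¹) ^ 2 := by
  have hL0 : (0 : ℝ) < L := by exact_mod_cast hL
  have hLk : (0 : ℝ) < ((L : ℝ) ^ k) ^ 2 := by positivity
  rw [inv_pow, ← div_eq_mul_inv, lt_div_iff₀ hLk]
  exact h

end Dev52

section Props810

variable {𝔸 : Type} [CStarAlgebra 𝔸] [Nontrivial 𝔸]

/-- **Proposition 8 AS TYPED (`B7.Prop8Printed`) for `concreteGaugeData 𝔸 L`** (`L ≥ 2`; `𝔸` a C⋆-algebra, `G = U(𝔸)`): `C₃ = 1116`, `c₆ = 1/3000` —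
`B7Prop8PrintedConstants.prop8_printed_of52` at the index's background (unitary, (52) at `c₂`), for unitary `u₁, u₂ ∈ Λ_k(U₀, α₃)`; the product is
unitary-valued. [cite: Balaban1985Averaging, Proposition 8 p.45, (166)–(167) p.44] -/
theorem prop8Printed_G (L : ℕ) (hL : 2 ≤ L) : B7.Prop8Printed (concreteGaugeData 𝔸 (d := d) L) := by
  have hL1 : 1 ≤ L := le_trans (by norm_num) hL
  have hL0 : (0 : ℝ) < L := by exact_mod_cast hL1
  refine ⟨1116, 1 / 3000, by norm_num, by norm_num, ?_⟩
  rintro ⟨k, U₀, hU₀, h52⟩ α₃ hα₃ hα₃c ⟨V, hVU⟩ u₁ u₂ ⟨hu₁, h₁⟩ ⟨hu₂, h₂⟩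
  dsimp only [concreteGaugeData] at hVU u₁ u₂ h₁ h₂ ⊢
  subst hVU
  refine ⟨fun x => (unitaryUnits 𝔸).mul_mem (hu₁ x) (hu₂ x), ?_⟩
  obtain ⟨hB3, hB2⟩ := cB_spec d L
  have hη : (0 : ℝ) ≤ ((L : ℝ) ^ k)⁻¹ := by positivity
  have hk : (L : ℝ) ^ k * ((L : ℝ) ^ k)⁻¹ ≤ 1 := by rw [mul_inv_cancel₀ (by positivity)]
  exact B7Prop8PrintedConstants.prop8_printed_of52 hL hη hk hα₃.le hα₃c hU₀ hu₁ hu₂ (cB_pos d hL1) hB3 hB2 (h52_of_lt hL1 h52)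
    h₁ h₂

/-- **Proposition 10 (203)–(204) AS TYPED (`B7.Prop10Printed`) for `concreteGaugeData 𝔸 L`** (`L ≥ 2`; `𝔸` a C⋆-algebra, `G = U(𝔸)`):
`C₄ = B7Prop10Flat.C4 d + 1`, `C′₅ = B7Prop9Flat.C5' d + 1`, `c₆ = c10 d L`.  For the index's background with the finer (52) `plaqDevEta < α₀ ≤ c₆`, `u′` with
(176)–(177) and a unitary `u₁ ∈ Λ_k(U₀, α₃)`: `B7Prop10AsPrinted.prop10_as_printed_of52` bounds every term of `avgDev203 … j` by
`α₄Lʲη + C₄(α₀α₄ + α₃α₄ + α₄²)(Lʲη)²` and every term of `avgDev204 … j` by `rhs204 ≤ α₄(1 + 4C′₅Lʲη)` (`rhs204_le_level`); the suprema follow and are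
strictly below the typed bounds with the constants `+1`. [cite: Balaban1985Averaging, Proposition 10 p.50, (203)–(204) p.49, (176)–(177) p.45, (166)–(167) p.44] -/
theorem prop10Printed_G (L : ℕ) (hL : 2 ≤ L) : B7.Prop10Printed (concreteGaugeData 𝔸 (d := d) L) := by
  have hL1 : 1 ≤ L := le_trans (by norm_num) hL
  have hL0 : (0 : ℝ) < L := by exact_mod_cast hL1
  have hd : (0 : ℝ) ≤ d := Nat.cast_nonneg d
  have hC5' := C5'_nonneg (d := d)
  have hC5 : 0 < C5 d := by linarith [one_le_C5 (d := d)]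
  have hC4' : 0 < B7Prop9Flat.C4' d := by unfold B7Prop9Flat.C4'; positivity
  have hC40 : 0 < C4 d := by unfold C4; positivity
  refine ⟨C4 d + 1, C5' d + 1, c10 d L, by positivity, by positivity, c10_pos d hL1, ?_⟩
  rintro ⟨k, U₀, hU₀, h52B⟩ α₀ α₃ α₄ hα₀ hα₀c hα₃ hα₃c hα₄ hα₄c ⟨V, hVU⟩ u' u₁ hdev ⟨h176, h177⟩ ⟨hu₁, hΛ⟩ j hj
  dsimp only [concreteGaugeData] at hVU u' u₁ hdev h176 h177 hΛ hj ⊢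
  subst hVU
  obtain ⟨cBle, c50, c20, c200, c3C4, c1024⟩ := c10_le d L
  obtain ⟨hB3, hB2⟩ := cB_spec d L
  -- the `α₀`-regime (finer than the index's): `C₀α₀ ≤ ⅓`, `2α₀ ≤ c₂′`
  have hα₀B : α₀ ≤ cB d L := hα₀c.trans cBle
  have hα3 : C0 d * α₀ ≤ 1 / 3 := (mul_le_mul_of_nonneg_left hα₀B (C0_pos d).le).trans hB3
  have hα2 : 2 * α₀ ≤ c2' d L := by linarith
  have h52 := h52_of_lt hL1 hdev
  -- the smallness of `prop10_as_printed_of52`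
  have hs₁ : 20 * C5 d * α₄ ≤ 1 := by
    have h := hα₄c.trans c20
    rw [le_div_iff₀ (by positivity)] at h
    linarith
  have hs₂ : 200 * (d : ℝ) * L * α₄ ≤ 1 := by
    have h := hα₄c.trans c200
    rw [le_div_iff₀ (by positivity)] at h
    nlinarith
  have hs₃ : C4 d * (α₀ + α₃ + α₄) ≤ 1 := by
    have h0 := hα₀c.trans c3C4
    have h3 := hα₃c.trans c3C4
    have h4 := hα₄c.trans c3C4
    rw [le_div_iff₀ (by positivity)] at h0 h3 h4
    nlinarith
  have hs₄ : 1024 * ((d : ℝ) + 1) * ((d : ℝ) + 4) * (L : ℝ) ^ 2 * α₀ ≤ 1 := by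
    have h := hα₀c.trans c1024
    rw [le_div_iff₀ (by positivity)] at h
    linarith
  obtain ⟨h203, h204⟩ := B7Prop10AsPrinted.prop10_as_printed_of52 hL (avgClosed_unitaryUnits d L) hU₀ hα₀ hα3 hα2 h52 h176 h177 hΛ
    hα₃.le (hα₃c.trans c50) hα₄.le hs₁ hs₂ hs₃ hs₄ j hj
  have ht : 0 < (L : ℝ) ^ j * ((L : ℝ) ^ k)⁻¹ := by positivity
  have hβ : 0 < α₀ * α₄ + α₃ * α₄ + α₄ ^ 2 := by positivity
  refine ⟨?_, ?_⟩
  · -- (203)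
    refine lt_of_le_of_lt (Real.iSup_le (fun c => h203 c.1 c.2) (by positivity)) ?_
    nlinarith [mul_pos hβ (pow_pos ht 2)]
  · -- (204)
    have hη : (0 : ℝ) ≤ ((L : ℝ) ^ k)⁻¹ := by positivity
    have h4 := rhs204_le_level (d := d) hL j hα₄.le hη
    refine lt_of_le_of_lt (Real.iSup_le (fun y => (h204 y).trans h4) (by positivity)) ?_
    nlinarith [mul_pos hα₄ ht]

/-- **The two gauge-transformation conjuncts of `B7.Concl` for ONE family**: `p8 ∧ p10` for `concreteGaugeData 𝔸 L`, `L ≥ 2`.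
[cite: Balaban1985Averaging, Proposition 8 p.45, Proposition 10 p.50] -/
theorem p8_and_p10_G (L : ℕ) (hL : 2 ≤ L) :
    B7.Prop8Printed (concreteGaugeData 𝔸 (d := d) L) ∧ B7.Prop10Printed (concreteGaugeData 𝔸 (d := d) L) :=
  ⟨prop8Printed_G L hL, prop10Printed_G L hL⟩

end Props810

end Literature.MathematicalPhysics.QuantumFieldTheory.Balaban1983to89.B7ConclGauge

end
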